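/-
Copyright (c) 2026. All rights reserved.
Released under Apache 2.0 license as described in the file LICENSE.
Authors: abc-iut cell, seat abc-iut-L4-t9 (gen 3, construction; gen 4, filing/split; block W2-B2, model of
[AbsTopIII] Cor 3.7).
-/
import Literature.AnabelianGeometry.AbsoluteAnabelian.AbsTopIII.MLFLogFrobeniusFunctors
import Literature.AnabelianGeometry.AbsoluteAnabelian.DiagramMorphisms
import Mathlib.Topology.Instances.ZMod
import HarnessLib

/-!
# [AbsTopIII] Cor 3.7 (v) and the "strictly Belyi type" restriction, part 1: the quadratic sign of
# `√p` and the twisting automorphism `η_B = (ψ_B, id)` of a model `TF`-pair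

S. Mochizuki, *Topics in absolute anabelian geometry III* [MochizukiAbsTopIII2015] (kurims manuscript
`paper:url-5493eb38cbb7`), §0 p. 27 ("we shall say that a functor `φ : 𝒞 → 𝒞'` is rigid if every
automorphism of `φ` is equal to the identity [...] id-rigid"); Cor 3.7 (v) p. 88 ("`𝒟*` is totally
`□`-rigid") for `𝒳 = 𝒞^{MLF-sB}_{TF}` — pairs OF STRICTLY BELYI TYPE (Def 3.1 (ii) p. 67: "if [...]
`Π_k ↠ G_k` arises from the étale fundamental group of [...] a hyperbolic orbicurve of strictly Belyi
type").

abc-iut-L4-t12's discharge `BiAnabelianSetting.cor_3_7_v_of_lift θ (hX : IsIdRigid X)` takes the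
id-rigidity of `𝒳` as input; for the MODEL category `𝒳 = TFModel p` of abc-iut-L4-t9
(`MLFGaloisModelCategories.lean`: Def 3.1 (i) model data `Π_k ↠ G_k` over `ℚ_p ⊆ k ⊆ ℚ̄_p` with
ARBITRARY topological groups `Π_k`; Galois-isomorphisms) this input FAILS (`TFModel.not_isIdRigid`, part 2
`BiAnabelianModelNonRigidity.lean`), while it HOLDS on the full subcategory of slim `Π_k`
(`TFModel.isIdRigid_slim`, `MLFGaloisModelIdRigid.lean`) — i.e. the `sB` restriction is load-bearing.
This part 1 builds the ingredients, for every model object `B`: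

* `sqrtPrime p = √p ∈ ℚ̄_p ∖ ℚ_p`, the quadratic sign `σ ↦ [σ(√p) = √p]` (multiplicative and
  conjugation-invariant: `fixes_sqrtPrime_mul`, `fixes_sqrtPrime_conj`), `exists_algEquiv_neg_sqrtPrime`;
* `kerElt B = z_B`, the non-trivial element of `ker ε_B` when that kernel has exactly two elements (else
  `1`); `twist`, `psi B = ψ_B : g ↦ g · z_B^{[ε_B(g)(√p) ≠ √p]}` — a continuous involutive automorphism of
  `Π_B` over `G_k` (`psiHomeo`); and `eta B = η_B := (ψ_B, id) : B ⟶ B`, a morphism of the model category.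

(For `Π_k` of strictly Belyi type, `ker(Π_k ↠ G_k) = Δ` is slim [AbsTopI], so no such `z_B` exists.)
HONEST FRAMING: statements about OUR model (which deliberately omits the `sB` condition,
plan/FOUNDATIONS row 12), clarifying which printed hypothesis the typed Cor 3.7 (v) discharge consumes;
nothing here contradicts print or bears on [IUTchIII] Cor. 3.12.
-/

set_option autoImplicit false

noncomputable section

namespace Literature.AnabelianGeometry.AbsoluteAnabelian.AbsTopIII

open CategoryTheory

variable (p : ℕ) [hp : Fact p.Prime]

/-! ## `√p ∈ ℚ̄_p ∖ ℚ_p` and the quadratic sign of a Galois automorphism -/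

/-- A square root of `p` in the algebraically closed field `ℚ̄_p`.
[cite: MochizukiAbsTopIII2015, Definition 3.1 (i) p.66] -/
def sqrtPrime : PadicAlgCl p :=
  Classical.choose (IsAlgClosed.exists_pow_nat_eq (p : PadicAlgCl p) two_pos)

/-- `(√p)² = p`. [cite: MochizukiAbsTopIII2015, Definition 3.1 (i) p.66] -/
theorem sqrtPrime_sq : sqrtPrime p ^ 2 = (p : PadicAlgCl p) :=
  Classical.choose_spec (IsAlgClosed.exists_pow_nat_eq (p : PadicAlgCl p) two_pos)

/-- `√p ≠ 0`. [cite: MochizukiAbsTopIII2015, Definition 3.1 (i) p.66] -/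
theorem sqrtPrime_ne_zero : sqrtPrime p ≠ 0 := fun h => by
  have := sqrtPrime_sq p
  rw [h, zero_pow two_ne_zero] at this
  exact Literature.NumberTheory.Transcendental.IwasawaLog.natCast_prime_ne_zero p this.symm

/-- `-√p ≠ √p` (characteristic `0`). [cite: MochizukiAbsTopIII2015, Definition 3.1 (i) p.66] -/
theorem neg_sqrtPrime_ne : -sqrtPrime p ≠ sqrtPrime p := fun h => by
  have h2 : (2 : PadicAlgCl p) * sqrtPrime p = 0 := by linear_combination -h
  rcases mul_eq_zero.mp h2 with h0 | h0
  · exact two_ne_zero h0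
  · exact sqrtPrime_ne_zero p h0

/-- `√p ∉ ℚ_p`: the `p`-adic valuation of `p` is odd. [cite: MochizukiAbsTopIII2015, Definition 3.1 (i) p.66] -/
theorem sqrtPrime_not_mem_range : sqrtPrime p ∉ Set.range (algebraMap ℚ_[p] (PadicAlgCl p)) := by
  rintro ⟨x, hx⟩
  have hx2 : algebraMap ℚ_[p] (PadicAlgCl p) (x ^ 2) = algebraMap ℚ_[p] (PadicAlgCl p) p := by
    rw [map_pow, hx, sqrtPrime_sq, map_natCast]
  have hx2' : x ^ 2 = p := (algebraMap ℚ_[p] (PadicAlgCl p)).injective hx2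
  have hv := Padic.valuation_pow x 2
  rw [hx2', Padic.valuation_p] at hv
  omega

/-- An automorphism of `ℚ̄_p` over any base sends `√p` to `±√p`.
[cite: MochizukiAbsTopIII2015, Definition 3.1 (i) p.66] -/
theorem algEquiv_sqrtPrime {F : Type*} [Field F] [Algebra F (PadicAlgCl p)] (σ : PadicAlgCl p ≃ₐ[F] PadicAlgCl p) :
    σ (sqrtPrime p) = sqrtPrime p ∨ σ (sqrtPrime p) = -sqrtPrime p := by
  have h : σ (sqrtPrime p) ^ 2 = sqrtPrime p ^ 2 := by rw [← map_pow, sqrtPrime_sq, map_natCast]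
  have h' : (σ (sqrtPrime p) - sqrtPrime p) * (σ (sqrtPrime p) + sqrtPrime p) = 0 := by
    linear_combination h
  rcases mul_eq_zero.mp h' with h0 | h0
  · exact Or.inl (sub_eq_zero.mp h0)
  · exact Or.inr (eq_neg_of_add_eq_zero_left h0)

/-- The quadratic sign is multiplicative: `στ` fixes `√p` iff (`σ` fixes `√p` iff `τ` fixes `√p`).
[cite: MochizukiAbsTopIII2015, Definition 3.1 (i) p.66] -/
theorem fixes_sqrtPrime_mul (σ τ : PadicAlgCl p ≃ₐ[ℚ_[p]] PadicAlgCl p) :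
    (σ * τ) (sqrtPrime p) = sqrtPrime p ↔
      (σ (sqrtPrime p) = sqrtPrime p ↔ τ (sqrtPrime p) = sqrtPrime p) := by
  have hne := neg_sqrtPrime_ne p
  rw [AlgEquiv.mul_apply]
  rcases algEquiv_sqrtPrime p τ with hτ | hτ <;> rcases algEquiv_sqrtPrime p σ with hσ | hσ
  · rw [hτ, hσ]; simp
  · rw [hτ, hσ]; simp [hne]
  · rw [hτ, map_neg, hσ]; simp [hne]
  · rw [hτ, map_neg, hσ, neg_neg]; simp [hne]

/-- The quadratic sign is invariant under conjugation `τ ↦ σ τ σ⁻¹` in `Gal(ℚ̄_p/ℚ_p)` (written with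
`AlgEquiv.trans`, as it arises in `TFModel.Hom.augQ_homPi`). [cite: MochizukiAbsTopIII2015, Definition 3.1 (i) p.66] -/
theorem fixes_sqrtPrime_conj (σ τ : PadicAlgCl p ≃ₐ[ℚ_[p]] PadicAlgCl p) :
    ((σ.symm.trans τ).trans σ) (sqrtPrime p) = sqrtPrime p ↔ τ (sqrtPrime p) = sqrtPrime p := by
  have hne := neg_sqrtPrime_ne p
  rw [AlgEquiv.trans_apply, AlgEquiv.trans_apply]
  rcases algEquiv_sqrtPrime p σ with hσ | hσ
  · have hσ' : σ.symm (sqrtPrime p) = sqrtPrime p := by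
      simpa using (congrArg σ.symm hσ).symm
    rw [hσ']
    rcases algEquiv_sqrtPrime p τ with hτ | hτ
    · rw [hτ, hσ]
    · rw [hτ, map_neg, hσ]
  · have hσ' : σ.symm (sqrtPrime p) = -sqrtPrime p := by
      have := congrArg σ.symm hσ
      rw [map_neg, AlgEquiv.symm_apply_apply] at this
      exact neg_eq_iff_eq_neg.mp this.symm
    rw [hσ', map_neg]
    rcases algEquiv_sqrtPrime p τ with hτ | hτ
    · rw [hτ, map_neg, hσ, neg_neg]
    · rw [hτ, neg_neg, hσ]

/-- Some `σ ∈ Gal(ℚ̄_p/ℚ_p)` negates `√p` (else `√p ∈ ℚ_p` by the Galois correspondence).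
[cite: MochizukiAbsTopIII2015, Definition 3.1 (i) p.66] -/
theorem exists_algEquiv_neg_sqrtPrime :
    ∃ σ : PadicAlgCl p ≃ₐ[ℚ_[p]] PadicAlgCl p, σ (sqrtPrime p) = -sqrtPrime p := by
  by_contra h
  push Not at h
  haveI := PadicAlgCl.isGalois (p := p)
  refine sqrtPrime_not_mem_range p ((InfiniteGalois.mem_range_algebraMap_iff_fixed _).2 fun σ => ?_)
  exact (algEquiv_sqrtPrime p σ).resolve_right (h σ)

namespace TFModel

variable {p}

/-! ## Kernel elements of order two and the twisting automorphism `ψ_B` of `Π_B` -/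

section Obj

variable (B : TFModel p)

/-- `ε_B` is multiplicative (for products formed in `Π_B`). [cite: MochizukiAbsTopIII2015, Definition 3.1 (i) p.66] -/
theorem aug_mul (g h : B.pair.Pi) : B.D.aug (g * h) = B.D.aug g * B.D.aug h := map_mul B.D.aug g h

/-- `ε_B(1) = 1`. [cite: MochizukiAbsTopIII2015, Definition 3.1 (i) p.66] -/
theorem aug_one : B.D.aug (1 : B.pair.Pi) = 1 := map_one B.D.aug

/-- `ε_B(g) = 1` iff `g` acts trivially on `k̄`. [cite: MochizukiAbsTopIII2015, Definition 3.1 (ii) p.67] -/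
theorem aug_eq_one_iff (g : B.pair.Pi) : B.D.aug g = 1 ↔ g ∈ B.pair.actionKer := by
  rw [B.mem_pair_actionKer_iff, AlgEquiv.ext_iff]
  exact Iff.rfl

/-- "The kernel of `ε_B` has exactly two elements, the non-trivial one being `z`".
[cite: MochizukiAbsTopIII2015, Definition 3.1 (i) p.66] -/
def IsKerTwo (z : B.pair.Pi) : Prop :=
  z ≠ 1 ∧ B.D.aug z = 1 ∧ ∀ g : B.pair.Pi, B.D.aug g = 1 → g = 1 ∨ g = z

variable {B} in
/-- The element `z` of `IsKerTwo` is unique. [cite: MochizukiAbsTopIII2015, Definition 3.1 (i) p.66] -/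
theorem IsKerTwo.unique {z z' : B.pair.Pi} (hz : B.IsKerTwo z) (hz' : B.IsKerTwo z') : z = z' :=
  (hz'.2.2 z hz.2.1).resolve_left hz.1

open Classical in
/-- The canonical kernel element `z_B` (`:= 1` if `ker ε_B` is not of order two).
[cite: MochizukiAbsTopIII2015, Definition 3.1 (i) p.66] -/
def kerElt : B.pair.Pi :=
  if h : ∃ z, B.IsKerTwo z then Classical.choose h else 1

variable {B} in
/-- `z_B` is the given `z` whenever `IsKerTwo B z`. [cite: MochizukiAbsTopIII2015, Definition 3.1 (i) p.66] -/
theorem kerElt_eq {z : B.pair.Pi} (hz : B.IsKerTwo z) : B.kerElt = z := by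
  have h : ∃ z, B.IsKerTwo z := ⟨z, hz⟩
  rw [kerElt, dif_pos h]
  exact (Classical.choose_spec h).unique hz

variable {B} in
/-- `z_B = 1` when `ker ε_B` is not of order two. [cite: MochizukiAbsTopIII2015, Definition 3.1 (i) p.66] -/
theorem kerElt_eq_one (h : ¬ ∃ z, B.IsKerTwo z) : B.kerElt = 1 := by
  rw [kerElt, dif_neg h]

/-- `ε_B(z_B) = 1`. [cite: MochizukiAbsTopIII2015, Definition 3.1 (i) p.66] -/
theorem aug_kerElt : B.D.aug B.kerElt = 1 := by
  by_cases h : ∃ z, B.IsKerTwo z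
  · obtain ⟨z, hz⟩ := h
    rw [kerElt_eq hz]; exact hz.2.1
  · rw [kerElt_eq_one h]; exact B.aug_one

/-- `z_B² = 1`. [cite: MochizukiAbsTopIII2015, Definition 3.1 (i) p.66] -/
theorem kerElt_mul_self : B.kerElt * B.kerElt = 1 := by
  by_cases h : ∃ z, B.IsKerTwo z
  · obtain ⟨z, hz⟩ := h
    rw [kerElt_eq hz]
    have hzz : B.D.aug (z * z) = 1 := by rw [aug_mul, hz.2.1, mul_one]
    rcases hz.2.2 _ hzz with h1 | h1
    · exact h1
    · exact absurd (mul_left_cancel (h1.trans (mul_one z).symm)) hz.1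
  · rw [kerElt_eq_one h, mul_one]

/-- `z_B` is central in `Π_B` (a normal subgroup of order two is central).
[cite: MochizukiAbsTopIII2015, Definition 3.1 (i) p.66] -/
theorem kerElt_comm (g : B.pair.Pi) : g * B.kerElt = B.kerElt * g := by
  by_cases h : ∃ z, B.IsKerTwo z
  · obtain ⟨z, hz⟩ := h
    rw [kerElt_eq hz]
    have hc : B.D.aug (g * z * g⁻¹) = 1 := by
      rw [aug_mul, aug_mul, hz.2.1, mul_one, ← aug_mul, mul_inv_cancel, aug_one]
    rcases hz.2.2 _ hc with h1 | h1
    · rw [mul_inv_eq_one] at h1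
      exact absurd ((mul_eq_left.mp h1)) hz.1
    · exact mul_inv_eq_iff_eq_mul.mp h1
  · rw [kerElt_eq_one h, mul_one, one_mul]

open Classical in
/-- The twist `t_B(g) ∈ {1, z_B}`: `z_B` iff `ε_B(g)` negates `√p`.
[cite: MochizukiAbsTopIII2015, Definition 3.1 (i) p.66] -/
def twist (g : B.pair.Pi) : B.pair.Pi :=
  if B.augQ g (sqrtPrime p) = sqrtPrime p then 1 else B.kerElt

/-- `t_B(g) = 1` if `ε_B(g)` fixes `√p`. [cite: MochizukiAbsTopIII2015, Definition 3.1 (i) p.66] -/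
theorem twist_of_fixes {g : B.pair.Pi} (h : B.augQ g (sqrtPrime p) = sqrtPrime p) : B.twist g = 1 := by
  rw [twist, if_pos h]

/-- `t_B(g) = z_B` if `ε_B(g)` negates `√p`. [cite: MochizukiAbsTopIII2015, Definition 3.1 (i) p.66] -/
theorem twist_of_not_fixes {g : B.pair.Pi} (h : ¬ B.augQ g (sqrtPrime p) = sqrtPrime p) :
    B.twist g = B.kerElt := by
  rw [twist, if_neg h]

/-- `t_B(g)` is central. [cite: MochizukiAbsTopIII2015, Definition 3.1 (i) p.66] -/
theorem twist_comm (g h : B.pair.Pi) : h * B.twist g = B.twist g * h := by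
  by_cases hg : B.augQ g (sqrtPrime p) = sqrtPrime p
  · rw [B.twist_of_fixes hg, mul_one, one_mul]
  · rw [B.twist_of_not_fixes hg]; exact B.kerElt_comm h

/-- `ε_B(t_B(g)) = 1`. [cite: MochizukiAbsTopIII2015, Definition 3.1 (i) p.66] -/
theorem aug_twist (g : B.pair.Pi) : B.D.aug (B.twist g) = 1 := by
  by_cases hg : B.augQ g (sqrtPrime p) = sqrtPrime p
  · rw [B.twist_of_fixes hg]; exact B.aug_one
  · rw [B.twist_of_not_fixes hg]; exact B.aug_kerElt

/-- `t_B(g)² = 1`. [cite: MochizukiAbsTopIII2015, Definition 3.1 (i) p.66] -/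
theorem twist_mul_self (g : B.pair.Pi) : B.twist g * B.twist g = 1 := by
  by_cases hg : B.augQ g (sqrtPrime p) = sqrtPrime p
  · rw [B.twist_of_fixes hg, mul_one]
  · rw [B.twist_of_not_fixes hg]; exact B.kerElt_mul_self

/-- `t_B` is multiplicative (the sign is a character and `z_B² = 1`).
[cite: MochizukiAbsTopIII2015, Definition 3.1 (i) p.66] -/
theorem twist_mul (g h : B.pair.Pi) : B.twist (g * h) = B.twist g * B.twist h := by
  have key := fixes_sqrtPrime_mul p (B.augQ g) (B.augQ h)
  rw [← augQ_mul] at key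
  by_cases hg : B.augQ g (sqrtPrime p) = sqrtPrime p <;>
    by_cases hh : B.augQ h (sqrtPrime p) = sqrtPrime p
  · rw [B.twist_of_fixes (key.2 (iff_of_true hg hh)), B.twist_of_fixes hg, B.twist_of_fixes hh, mul_one]
  · rw [B.twist_of_not_fixes (fun H => hh ((key.1 H).1 hg)), B.twist_of_fixes hg,
      B.twist_of_not_fixes hh, one_mul]
  · rw [B.twist_of_not_fixes (fun H => hg ((key.1 H).2 hh)), B.twist_of_not_fixes hg,
      B.twist_of_fixes hh, mul_one]
  · rw [B.twist_of_fixes (key.2 (iff_of_false hg hh)), B.twist_of_not_fixes hg, B.twist_of_not_fixes hh,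
      B.kerElt_mul_self]

/-- `t_B` of a kernel element is `1`. [cite: MochizukiAbsTopIII2015, Definition 3.1 (i) p.66] -/
theorem twist_of_aug_eq_one {g : B.pair.Pi} (h : B.D.aug g = 1) : B.twist g = 1 := by
  apply B.twist_of_fixes
  rw [augQ_apply, h, AlgEquiv.one_apply]

/-- **The twisting endomorphism** `ψ_B(g) = g · t_B(g)` of `Π_B` (a group homomorphism since `t_B` is a
central-valued character). [cite: MochizukiAbsTopIII2015, Section 0 p.27] -/
def psi : B.pair.Pi →* B.pair.Pi where
  toFun g := g * B.twist g
  map_one' := by rw [B.twist_of_aug_eq_one B.aug_one, mul_one]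
  map_mul' g h := by
    rw [twist_mul, ← mul_assoc, ← mul_assoc, mul_assoc g h, B.twist_comm g h, ← mul_assoc]

/-- `ψ_B(g) = g · t_B(g)`. [cite: MochizukiAbsTopIII2015, Section 0 p.27] -/
theorem psi_apply (g : B.pair.Pi) : B.psi g = g * B.twist g := rfl

/-- `ε_B ∘ ψ_B = ε_B`. [cite: MochizukiAbsTopIII2015, Section 0 p.27] -/
theorem aug_psi (g : B.pair.Pi) : B.D.aug (B.psi g) = B.D.aug g := by
  rw [psi_apply, aug_mul, aug_twist, mul_one]

/-- `ψ_B` is an involution. [cite: MochizukiAbsTopIII2015, Section 0 p.27] -/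
theorem psi_psi (g : B.pair.Pi) : B.psi (B.psi g) = g := by
  rw [psi_apply, psi_apply, twist_mul, B.twist_of_aug_eq_one (B.aug_twist g), mul_one, mul_assoc,
    twist_mul_self, mul_one]

/-- The set of `g ∈ Π_B` with `ε_B(g)(√p) = √p` is open (preimage of the Krull-open stabiliser under the
continuous `ε_B`). [cite: MochizukiAbsTopIII2015, Definition 3.1 (i) p.67] -/
theorem isOpen_fixes : IsOpen {g : B.pair.Pi | B.augQ g (sqrtPrime p) = sqrtPrime p} := by
  haveI := B.isAlgebraic
  have h := B.D.isOpen_stabilizer_comp (sqrtPrime p)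
  have hset : {g : B.pair.Pi | B.augQ g (sqrtPrime p) = sqrtPrime p} =
      (MulAction.stabilizer (PadicAlgCl p ≃ₐ[B.k] PadicAlgCl p) (sqrtPrime p) :
        Set (PadicAlgCl p ≃ₐ[B.k] PadicAlgCl p)).preimage B.D.aug := by
    ext g
    change B.augQ g (sqrtPrime p) = sqrtPrime p ↔
      B.D.aug g ∈ (MulAction.stabilizer (PadicAlgCl p ≃ₐ[B.k] PadicAlgCl p) (sqrtPrime p) : Set _)
    rw [SetLike.mem_coe, MulAction.mem_stabilizer_iff, AlgEquiv.smul_def, augQ_apply]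
  rw [hset]
  exact h

/-- The complementary set (`ε_B(g)(√p) = -√p`) is open as well (a union of left translates of the
former). [cite: MochizukiAbsTopIII2015, Definition 3.1 (i) p.67] -/
theorem isOpen_not_fixes : IsOpen {g : B.pair.Pi | ¬ B.augQ g (sqrtPrime p) = sqrtPrime p} := by
  refine isOpen_iff_forall_mem_open.2 fun t ht =>
    ⟨(t * ·) '' {g : B.pair.Pi | B.augQ g (sqrtPrime p) = sqrtPrime p}, ?_,
      (isOpenMap_mul_left t) _ B.isOpen_fixes, ⟨1, ?_, mul_one t⟩⟩
  · rintro _ ⟨g, hg, rfl⟩ H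
    have key := (fixes_sqrtPrime_mul p (B.augQ t) (B.augQ g)).1 (by rw [← augQ_mul]; exact H)
    exact ht (key.2 hg)
  · change B.augQ 1 (sqrtPrime p) = sqrtPrime p
    rw [augQ_one, AlgEquiv.one_apply]

/-- `t_B` is locally constant, hence `ψ_B` is continuous. [cite: MochizukiAbsTopIII2015, Section 0 p.27] -/
theorem continuous_psi : Continuous B.psi := by
  have ht : IsLocallyConstant B.twist := by
    intro s
    have hs : B.twist ⁻¹' s =
        ({g | B.augQ g (sqrtPrime p) = sqrtPrime p} ∩ {_g | (1 : B.pair.Pi) ∈ s}) ∪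
        ({g | ¬ B.augQ g (sqrtPrime p) = sqrtPrime p} ∩ {_g | B.kerElt ∈ s}) := by
      ext g
      simp only [Set.mem_preimage, Set.mem_union, Set.mem_inter_iff, Set.mem_setOf_eq]
      by_cases hg : B.augQ g (sqrtPrime p) = sqrtPrime p
      · rw [B.twist_of_fixes hg]
        simp only [hg, true_and, not_true_eq_false, false_and, or_false]
      · rw [B.twist_of_not_fixes hg]
        simp only [hg, false_and, not_false_eq_true, true_and, false_or]
    rw [hs]
    exact ((B.isOpen_fixes).inter isOpen_const).union ((B.isOpen_not_fixes).inter isOpen_const)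
  exact continuous_id.mul ht.continuous

/-- `ψ_B` as a homeomorphism (it is its own inverse). [cite: MochizukiAbsTopIII2015, Section 0 p.27] -/
def psiHomeo : B.pair.Pi ≃ₜ B.pair.Pi where
  toFun := B.psi
  invFun := B.psi
  left_inv := B.psi_psi
  right_inv := B.psi_psi
  continuous_toFun := B.continuous_psi
  continuous_invFun := B.continuous_psi

/-! ## The automorphism `η_B = (ψ_B, id)` of every model object, natural in `B` -/

/-- **`η_B = (ψ_B, id_{ℚ̄_p})`**, an automorphism of the model pair `B` (a Galois-isomorphism with
`φ_M = id`). [cite: MochizukiAbsTopIII2015, Section 0 p.27] -/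
def eta : B ⟶ B where
  hom :=
    { homPi := B.psi
      continuous_homPi := B.continuous_psi
      homM := RingHom.id _
      smul_comm := fun g x => by
        change B.augQ g x = B.augQ (B.psi g) x
        rw [augQ_apply, augQ_apply, B.aug_psi g]
      comap_ker := by
        ext g
        rw [Subgroup.mem_comap, ← B.aug_eq_one_iff, ← B.aug_eq_one_iff, B.aug_psi g]
      isOpen_image := fun U hU =>
        Subgroup.isOpen_mono le_sup_left (B.psiHomeo.isOpenMap _ hU) }
  bijective := B.psiHomeo.bijective
  isOpenMap := B.psiHomeo.isOpenMap

/-- `η_B` on `Π_B` is `ψ_B`. [cite: MochizukiAbsTopIII2015, Section 0 p.27] -/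
@[simp] theorem eta_homPi_apply (g : B.pair.Pi) : (B.eta : Hom B B).hom.homPi g = B.psi g := rfl

/-- `η_B` on `k̄` is the identity. [cite: MochizukiAbsTopIII2015, Section 0 p.27] -/
@[simp] theorem eta_homM_apply (x : B.pair.M) : (B.eta : Hom B B).hom.homM x = x := rfl

end Obj

end TFModel

end Literature.AnabelianGeometry.AbsoluteAnabelian.AbsTopIII

end
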